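import Summits.Ventures.Crystal3D.Theorems.StickyWulffConstantNoReconstructionGainPredSlotBudgetRaisedThreeCoordsTwin
import Summits.Ventures.Crystal3D.Theorems.StickyWulffConstantNoReconstructionGainPredSlotBudgetRaisedThreeLevel
import Summits.Ventures.Crystal3D.Theorems.StickyWulffConstantNoReconstructionGainPredSlotBudgetRaisedCore
import HarnessLib

/-!
# The pred-slot budget with a raised up bond: three contacts (the frame core)

HONEST FRAMING. Part of the venture `Summits/Ventures/Crystal3D` (cell `crystal3d-full`), helper
`--supports` the crux `NoReconstructionGain` (stmt-Ventures-19144, route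
`route-Ventures-StickyWulffConstant`), line `adhesion` (wulff-p1 g15).  The frame-level core of B1b₃
(`predSlotBudget_of_upBond_raised_three`, skeleton v21): `predSlotBudget_coreR_three` — raised `w₃`,
exactly three contacts, hex representatives `±A h_j` — by cubic coordinates (`…GrainFrameBudgetThree`),
the credit feeds of `…RaisedCore`, the landed cap budgets (`…RaisedLanded`, `…RaisedThreeLevel`) and the
coordinate case analysis `coreR_three_coords'`.

WHAT THIS IS NOT: the rotations to `w₁`, `w₂` and the by-name theorem (next file); rung F-C1 not moved.
-/

noncomputable section

namespace Summit.Ventures.Crystal3D.Theorems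

open Summit.Ventures.Crystal3D Finset
open Literature.MathematicalPhysics.StatisticalMechanics (fccStacking barlowPos constHagg barlowPos_mem
  threeOffsets barlowPos_apply_zero barlowPos_apply_one barlowPos_apply_two haggLabel_const)
open Literature.Algebra.EuclideanLattices (inner_fin_three norm_sq_fin_three)
open scoped InnerProductSpace

set_option maxHeartbeats 1600000 in
/-- **CORE (raised frame, `#K = 3`).**  In a lattice frame `A` whose axis is within `70.5°` of `−ν` and
whose up bond `A w₃` is `ν`-raised, the pred-slot budget holds for three contacts and hex representatives
`g_j = ±A h_j`.  Cubic coordinates, the three contacts, the credit feeds, and `coreR_three_coords` in the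
mirror orientation with `a + b ≥ 0` (for `a + b = 0` the orientation is chosen by the sign of `g₁`), fed
with the landed cap budgets `predSlotBudget_coreR_landed` / `predSlotBudget_coreR_landed_level`. -/
theorem predSlotBudget_coreR_three (A : EuclideanSpace ℝ (Fin 3) ≃ₗᵢ[ℝ] EuclideanSpace ℝ (Fin 3))
    (ν : EuclideanSpace ℝ (Fin 3)) (hν : ‖ν‖ = 1)
    (haxis : ⟪ν, A (EuclideanSpace.single (2 : Fin 3) (1 : ℝ))⟫_ℝ ≤ -(1 / 3)) (t : ℝ) (ht : 0 < t)
    (K : Finset (EuclideanSpace ℝ (Fin 3))) (hK : K.card = 3)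
    (hK1 : ∀ u ∈ K, ‖u‖ = 1 ∧ ⟪u, ν⟫_ℝ ≤ -t) (hK2 : ∀ u ∈ K, ∀ u' ∈ K, u ≠ u' → ⟪u, u'⟫_ℝ ≤ 1 / 2)
    (g₁ g₂ g₃ : EuclideanSpace ℝ (Fin 3))
    (hg₁ : g₁ = A (barlowPos 1 (Real.sqrt (2 / 3)) constHagg 0 1 0) ∨ g₁ = -A (barlowPos 1 (Real.sqrt (2 / 3)) constHagg 0 1 0))
    (hg₂ : g₂ = A (barlowPos 1 (Real.sqrt (2 / 3)) constHagg 0 0 1) ∨ g₂ = -A (barlowPos 1 (Real.sqrt (2 / 3)) constHagg 0 0 1))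
    (hg₃ : g₃ = A (barlowPos 1 (Real.sqrt (2 / 3)) constHagg 0 1 (-1)) ∨ g₃ = -A (barlowPos 1 (Real.sqrt (2 / 3)) constHagg 0 1 (-1)))
    (hraised : 0 ≤ ⟪A (barlowPos 1 (Real.sqrt (2 / 3)) constHagg 1 0 (-1)), ν⟫_ℝ) :
    (K.card : ℝ) ≤
      (if (∃ u ∈ K, 1 / 2 < ⟪u, if ⟪g₁, ν⟫_ℝ < 0 then g₁ else -g₁⟫_ℝ) ∨
          ⟪(if ⟪g₁, ν⟫_ℝ < 0 then g₁ else -g₁), ν⟫_ℝ ≤ -t then (1 : ℝ) else 0) +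
      (if (∃ u ∈ K, 1 / 2 < ⟪u, if ⟪g₂, ν⟫_ℝ < 0 then g₂ else -g₂⟫_ℝ) ∨
          ⟪(if ⟪g₂, ν⟫_ℝ < 0 then g₂ else -g₂), ν⟫_ℝ ≤ -t then (1 : ℝ) else 0) +
      (if (∃ u ∈ K, 1 / 2 < ⟪u, if ⟪g₃, ν⟫_ℝ < 0 then g₃ else -g₃⟫_ℝ) ∨
          ⟪(if ⟪g₃, ν⟫_ℝ < 0 then g₃ else -g₃), ν⟫_ℝ ≤ -t then (1 : ℝ) else 0) +
      (if (∃ u ∈ K, 1 / 2 < ⟪u, A (barlowPos 1 (Real.sqrt (2 / 3)) constHagg 1 0 0)⟫_ℝ) ∨ ⟪A (barlowPos 1 (Real.sqrt (2 / 3)) constHagg 1 0 0), ν⟫_ℝ ≤ -t then (1 : ℝ) else 0) +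
      (if (∃ u ∈ K, 1 / 2 < ⟪u, A (barlowPos 1 (Real.sqrt (2 / 3)) constHagg 1 (-1) 0)⟫_ℝ) ∨ ⟪A (barlowPos 1 (Real.sqrt (2 / 3)) constHagg 1 (-1) 0), ν⟫_ℝ ≤ -t then (1 : ℝ) else 0) +
      (if (∃ u ∈ K, 1 / 2 < ⟪u, A (barlowPos 1 (Real.sqrt (2 / 3)) constHagg 1 0 (-1))⟫_ℝ) ∨ ⟪A (barlowPos 1 (Real.sqrt (2 / 3)) constHagg 1 0 (-1)), ν⟫_ℝ ≤ -t then (1 : ℝ) else 0) := by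
  classical
  -- cubic coordinates of the pulled-back normal
  obtain ⟨S, hSdef⟩ : ∃ S', S' = A.symm (-ν) := ⟨_, rfl⟩
  obtain ⟨a, hadef⟩ : ∃ a', a' = S 0 + Real.sqrt 3 / 3 * S 1 - Real.sqrt (2 / 3) * S 2 := ⟨_, rfl⟩
  obtain ⟨b, hbdef⟩ : ∃ b', b' = S 0 - Real.sqrt 3 / 3 * S 1 + Real.sqrt (2 / 3) * S 2 := ⟨_, rfl⟩
  obtain ⟨c, hcdef⟩ : ∃ c', c' = 2 * Real.sqrt 3 / 3 * S 1 + Real.sqrt (2 / 3) * S 2 := ⟨_, rfl⟩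
  have hSn : ‖S‖ = 1 := by rw [hSdef, LinearIsometryEquiv.norm_map, norm_neg, hν]
  have hn : a ^ 2 + b ^ 2 + c ^ 2 = 2 := by
    have h := cubic_inner S S
    rw [real_inner_self_eq_norm_sq, hSn] at h
    rw [hadef, hbdef, hcdef]; nlinarith [h]
  have hνS : ∀ w : EuclideanSpace ℝ (Fin 3), ⟪A w, ν⟫_ℝ = -⟪w, S⟫_ℝ := by
    intro w
    have : ⟪w, S⟫_ℝ = -⟪A w, ν⟫_ℝ := by
      rw [hSdef, ← A.inner_map_map, LinearIsometryEquiv.apply_symm_apply, inner_neg_right]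
    linarith only [this]
  have hdep : ∀ k i j : ℤ, 2 * ⟪A (barlowPos 1 (Real.sqrt (2 / 3)) constHagg k i j), ν⟫_ℝ =
      -(((i : ℝ) + j) * a + ((k : ℝ) + i) * b + ((k : ℝ) + j) * c) := by
    intro k i j
    have h := inner_barlowPos_cubic k i j S
    rw [← hadef, ← hbdef, ← hcdef] at h
    rw [hνS]; linarith only [h]
  -- the axis condition `−a + b + c ≥ √(2/3)` and the raised bond `b ≤ a`
  have h23 : Real.sqrt (2 / 3) ^ 2 = 2 / 3 := Real.sq_sqrt (by norm_num)
  have hS2 : 1 / 3 ≤ S 2 := by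
    have h1 : ⟪ν, A (EuclideanSpace.single (2 : Fin 3) (1 : ℝ))⟫_ℝ = -S 2 := by
      rw [real_inner_comm, hνS, bgf_inner_e3_left]
    linarith only [h1, haxis]
  have hs : Real.sqrt (2 / 3) ≤ -a + b + c := by
    have : -a + b + c = 3 * Real.sqrt (2 / 3) * S 2 := by rw [hadef, hbdef, hcdef]; ring
    rw [this]; nlinarith [Real.sqrt_nonneg (2 / 3)]
  have hba : b ≤ a := by
    have h := hdep 1 0 (-1)
    push_cast at h
    linarith only [h, hraised]
  -- depths of the six slots
  have dH1 := hdep 0 1 0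
  have dH2 := hdep 0 0 1
  have dH3 := hdep 0 1 (-1)
  have dW1 := hdep 1 0 0
  have dW2 := hdep 1 (-1) 0
  push_cast at dH1 dH2 dH3 dW1 dW2
  -- feeding the credit propositions of the statement
  have feedB2 : 0 < a + c → ((∃ u ∈ K, 1 < 2 * ⟪u, A (barlowPos 1 (Real.sqrt (2 / 3)) constHagg 0 0 1)⟫_ℝ) ∨ 2 * t ≤ a + c) →
      ((∃ u ∈ K, 1 / 2 < ⟪u, if ⟪g₂, ν⟫_ℝ < 0 then g₂ else -g₂⟫_ℝ) ∨
          ⟪(if ⟪g₂, ν⟫_ℝ < 0 then g₂ else -g₂), ν⟫_ℝ ≤ -t) := by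
    intro hac h
    have hlt : ⟪A (barlowPos 1 (Real.sqrt (2 / 3)) constHagg 0 0 1), ν⟫_ℝ < 0 := by linarith only [hac, dH2]
    have hlow : (if ⟪g₂, ν⟫_ℝ < 0 then g₂ else -g₂) = A (barlowPos 1 (Real.sqrt (2 / 3)) constHagg 0 0 1) := by
      rcases hg₂ with rfl | rfl
      · rw [if_pos hlt]
      · rw [if_neg (by rw [inner_neg_left]; linarith only [hlt]), neg_neg]
    rw [hlow]
    rcases h with ⟨u, hu, h⟩ | h
    · exact Or.inl ⟨u, hu, by linarith only [h]⟩
    · exact Or.inr (by linarith only [h, dH2])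
  have feedB3 : b < c → ((∃ u ∈ K, 1 < 2 * ⟪u, -A (barlowPos 1 (Real.sqrt (2 / 3)) constHagg 0 1 (-1))⟫_ℝ) ∨ 2 * t ≤ c - b) →
      ((∃ u ∈ K, 1 / 2 < ⟪u, if ⟪g₃, ν⟫_ℝ < 0 then g₃ else -g₃⟫_ℝ) ∨
          ⟪(if ⟪g₃, ν⟫_ℝ < 0 then g₃ else -g₃), ν⟫_ℝ ≤ -t) := by
    intro hbc h
    have hgt : 0 < ⟪A (barlowPos 1 (Real.sqrt (2 / 3)) constHagg 0 1 (-1)), ν⟫_ℝ := by linarith only [hbc, dH3]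
    have hlow : (if ⟪g₃, ν⟫_ℝ < 0 then g₃ else -g₃) = -A (barlowPos 1 (Real.sqrt (2 / 3)) constHagg 0 1 (-1)) := by
      rcases hg₃ with rfl | rfl
      · rw [if_neg (not_lt.2 hgt.le)]
      · rw [if_pos (by rw [inner_neg_left]; linarith only [hgt])]
    rw [hlow]
    rcases h with ⟨u, hu, h⟩ | h
    · exact Or.inl ⟨u, hu, by linarith only [h]⟩
    · exact Or.inr (by rw [inner_neg_left]; linarith only [h, dH3])
  have feedW1 : ((∃ u ∈ K, 1 < 2 * ⟪u, A (barlowPos 1 (Real.sqrt (2 / 3)) constHagg 1 0 0)⟫_ℝ) ∨ 2 * t ≤ b + c) →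
      ((∃ u ∈ K, 1 / 2 < ⟪u, A (barlowPos 1 (Real.sqrt (2 / 3)) constHagg 1 0 0)⟫_ℝ) ∨ ⟪A (barlowPos 1 (Real.sqrt (2 / 3)) constHagg 1 0 0), ν⟫_ℝ ≤ -t) := by
    rintro (⟨u, hu, h⟩ | h)
    · exact Or.inl ⟨u, hu, by linarith only [h]⟩
    · exact Or.inr (by linarith only [h, dW1])
  have feedW2 : ((∃ u ∈ K, 1 < 2 * ⟪u, A (barlowPos 1 (Real.sqrt (2 / 3)) constHagg 1 (-1) 0)⟫_ℝ) ∨ 2 * t ≤ c - a) →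
      ((∃ u ∈ K, 1 / 2 < ⟪u, A (barlowPos 1 (Real.sqrt (2 / 3)) constHagg 1 (-1) 0)⟫_ℝ) ∨ ⟪A (barlowPos 1 (Real.sqrt (2 / 3)) constHagg 1 (-1) 0), ν⟫_ℝ ≤ -t) := by
    rintro (⟨u, hu, h⟩ | h)
    · exact Or.inl ⟨u, hu, by linarith only [h]⟩
    · exact Or.inr (by linarith only [h, dW2])
  -- nonnegativity of all six credits
  have n₁ : (0 : ℝ) ≤ (if (∃ u ∈ K, 1 / 2 < ⟪u, if ⟪g₁, ν⟫_ℝ < 0 then g₁ else -g₁⟫_ℝ) ∨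
          ⟪(if ⟪g₁, ν⟫_ℝ < 0 then g₁ else -g₁), ν⟫_ℝ ≤ -t then (1 : ℝ) else 0) := by split_ifs <;> norm_num
  have n₂ : (0 : ℝ) ≤ (if (∃ u ∈ K, 1 / 2 < ⟪u, if ⟪g₂, ν⟫_ℝ < 0 then g₂ else -g₂⟫_ℝ) ∨
          ⟪(if ⟪g₂, ν⟫_ℝ < 0 then g₂ else -g₂), ν⟫_ℝ ≤ -t then (1 : ℝ) else 0) := by split_ifs <;> norm_num
  have n₃ : (0 : ℝ) ≤ (if (∃ u ∈ K, 1 / 2 < ⟪u, if ⟪g₃, ν⟫_ℝ < 0 then g₃ else -g₃⟫_ℝ) ∨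
          ⟪(if ⟪g₃, ν⟫_ℝ < 0 then g₃ else -g₃), ν⟫_ℝ ≤ -t then (1 : ℝ) else 0) := by split_ifs <;> norm_num
  have n₄ : (0 : ℝ) ≤ (if (∃ u ∈ K, 1 / 2 < ⟪u, A (barlowPos 1 (Real.sqrt (2 / 3)) constHagg 1 0 0)⟫_ℝ) ∨ ⟪A (barlowPos 1 (Real.sqrt (2 / 3)) constHagg 1 0 0), ν⟫_ℝ ≤ -t then (1 : ℝ) else 0) := by split_ifs <;> norm_num
  have n₅ : (0 : ℝ) ≤ (if (∃ u ∈ K, 1 / 2 < ⟪u, A (barlowPos 1 (Real.sqrt (2 / 3)) constHagg 1 (-1) 0)⟫_ℝ) ∨ ⟪A (barlowPos 1 (Real.sqrt (2 / 3)) constHagg 1 (-1) 0), ν⟫_ℝ ≤ -t then (1 : ℝ) else 0) := by split_ifs <;> norm_num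
  have n₆ : (0 : ℝ) ≤ (if (∃ u ∈ K, 1 / 2 < ⟪u, A (barlowPos 1 (Real.sqrt (2 / 3)) constHagg 1 0 (-1))⟫_ℝ) ∨ ⟪A (barlowPos 1 (Real.sqrt (2 / 3)) constHagg 1 0 (-1)), ν⟫_ℝ ≤ -t then (1 : ℝ) else 0) := by split_ifs <;> norm_num
  have hpos : 0 < Real.sqrt (2 / 3) := Real.sqrt_pos.2 (by norm_num)
  have dW3 := hdep 1 0 (-1)
  push_cast at dW3
  -- the three contacts
  obtain ⟨u₁, u₂, u₃, n12, n13, n23, hKe⟩ := card_eq_three.1 hK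
  have m1 : u₁ ∈ K := by rw [hKe]; simp
  have m2 : u₂ ∈ K := by rw [hKe]; simp
  have m3 : u₃ ∈ K := by rw [hKe]; simp
  obtain ⟨x₁, y₁, z₁, hx₁, hy₁, hz₁, hu₁, hd₁, hb₁⟩ :=
    contact_coords A ν S hSdef a b c hadef hbdef hcdef u₁ (hK1 u₁ m1).1
  obtain ⟨x₂, y₂, z₂, hx₂, hy₂, hz₂, hu₂, hd₂, hb₂⟩ :=
    contact_coords A ν S hSdef a b c hadef hbdef hcdef u₂ (hK1 u₂ m2).1
  obtain ⟨x₃, y₃, z₃, hx₃, hy₃, hz₃, hu₃, hd₃, hb₃⟩ :=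
    contact_coords A ν S hSdef a b c hadef hbdef hcdef u₃ (hK1 u₃ m3).1
  have hT₁ : 2 * t ≤ a * x₁ + b * y₁ + c * z₁ := by rw [hd₁]; linarith only [(hK1 u₁ m1).2]
  have hT₂ : 2 * t ≤ a * x₂ + b * y₂ + c * z₂ := by rw [hd₂]; linarith only [(hK1 u₂ m2).2]
  have hT₃ : 2 * t ≤ a * x₃ + b * y₃ + c * z₃ := by rw [hd₃]; linarith only [(hK1 u₃ m3).2]
  have h12 : x₁ * x₂ + y₁ * y₂ + z₁ * z₂ ≤ 1 := by
    rw [contact_pair A u₁ u₂ hx₁ hy₁ hz₁ hx₂ hy₂ hz₂]; linarith only [hK2 u₁ m1 u₂ m2 n12]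
  have h13 : x₁ * x₃ + y₁ * y₃ + z₁ * z₃ ≤ 1 := by
    rw [contact_pair A u₁ u₃ hx₁ hy₁ hz₁ hx₃ hy₃ hz₃]; linarith only [hK2 u₁ m1 u₃ m3 n13]
  have h23 : x₂ * x₃ + y₂ * y₃ + z₂ * z₃ ≤ 1 := by
    rw [contact_pair A u₂ u₃ hx₂ hy₂ hz₂ hx₃ hy₃ hz₃]; linarith only [hK2 u₂ m2 u₃ m3 n23]
  have c11 := hb₁ 0 1 0; have c12 := hb₁ 0 0 1; have c13 := hb₁ 0 1 (-1)
  have c14 := hb₁ 1 0 0; have c15 := hb₁ 1 (-1) 0; have c16 := hb₁ 1 0 (-1)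
  have c21 := hb₂ 0 1 0; have c22 := hb₂ 0 0 1; have c23 := hb₂ 0 1 (-1)
  have c24 := hb₂ 1 0 0; have c25 := hb₂ 1 (-1) 0; have c26 := hb₂ 1 0 (-1)
  have c31 := hb₃ 0 1 0; have c32 := hb₃ 0 0 1; have c33 := hb₃ 0 1 (-1)
  have c34 := hb₃ 1 0 0; have c35 := hb₃ 1 (-1) 0; have c36 := hb₃ 1 0 (-1)
  push_cast at c11 c12 c13 c14 c15 c16 c21 c22 c23 c24 c25 c26 c31 c32 c33 c34 c35 c36
  -- blocking of a bond by one of the three contacts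
  have blk : ∀ v : EuclideanSpace ℝ (Fin 3), (∃ u ∈ K, 1 / 2 < ⟪u, v⟫_ℝ) →
      1 / 2 < ⟪u₁, v⟫_ℝ ∨ 1 / 2 < ⟪u₂, v⟫_ℝ ∨ 1 / 2 < ⟪u₃, v⟫_ℝ := by
    rintro v ⟨u, hu, h⟩
    rw [hKe] at hu
    simp only [mem_insert, mem_singleton] at hu
    rcases hu with rfl | rfl | rfl
    · exact Or.inl h
    · exact Or.inr (Or.inl h)
    · exact Or.inr (Or.inr h)
  -- feeds from three-contact coordinate disjunctions
  have or3 : ∀ (v : EuclideanSpace ℝ (Fin 3)) {p₁ p₂ p₃ q : Prop},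
      (p₁ → 1 < 2 * ⟪u₁, v⟫_ℝ) → (p₂ → 1 < 2 * ⟪u₂, v⟫_ℝ) → (p₃ → 1 < 2 * ⟪u₃, v⟫_ℝ) →
      (p₁ ∨ p₂ ∨ p₃ ∨ q) → ((∃ u ∈ K, 1 < 2 * ⟪u, v⟫_ℝ) ∨ q) := by
    intro v p₁ p₂ p₃ q f1 f2 f3 h
    rcases h with h | h | h | h
    · exact Or.inl ⟨u₁, m1, f1 h⟩
    · exact Or.inl ⟨u₂, m2, f2 h⟩
    · exact Or.inl ⟨u₃, m3, f3 h⟩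
    · exact Or.inr h
  have or3' : ∀ (v : EuclideanSpace ℝ (Fin 3)) {p₁ p₂ p₃ : Prop},
      (p₁ → 1 / 2 < ⟪u₁, v⟫_ℝ) → (p₂ → 1 / 2 < ⟪u₂, v⟫_ℝ) → (p₃ → 1 / 2 < ⟪u₃, v⟫_ℝ) →
      (p₁ ∨ p₂ ∨ p₃) → (∃ u ∈ K, 1 / 2 < ⟪u, v⟫_ℝ) := by
    intro v p₁ p₂ p₃ f1 f2 f3 h
    rcases h with h | h | h
    · exact ⟨u₁, m1, f1 h⟩
    · exact ⟨u₂, m2, f2 h⟩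
    · exact ⟨u₃, m3, f3 h⟩
  -- representative-based feeds for the first hex pair
  have feedB1P : (if ⟪g₁, ν⟫_ℝ < 0 then g₁ else -g₁) = A (barlowPos 1 (Real.sqrt (2 / 3)) constHagg 0 1 0) →
      ((∃ u ∈ K, 1 / 2 < ⟪u, A (barlowPos 1 (Real.sqrt (2 / 3)) constHagg 0 1 0)⟫_ℝ) ∨ (0 < a + b ∧ 2 * t ≤ a + b)) → ((∃ u ∈ K, 1 / 2 < ⟪u, if ⟪g₁, ν⟫_ℝ < 0 then g₁ else -g₁⟫_ℝ) ∨
          ⟪(if ⟪g₁, ν⟫_ℝ < 0 then g₁ else -g₁), ν⟫_ℝ ≤ -t) := by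
    intro hlow h; rw [hlow]
    rcases h with h | ⟨-, h⟩
    · exact Or.inl h
    · exact Or.inr (by linarith only [h, dH1])
  have feedB1M : (if ⟪g₁, ν⟫_ℝ < 0 then g₁ else -g₁) = -A (barlowPos 1 (Real.sqrt (2 / 3)) constHagg 0 1 0) →
      ((∃ u ∈ K, 1 / 2 < ⟪u, -A (barlowPos 1 (Real.sqrt (2 / 3)) constHagg 0 1 0)⟫_ℝ) ∨ (0 < -b + -a ∧ 2 * t ≤ -b + -a)) → ((∃ u ∈ K, 1 / 2 < ⟪u, if ⟪g₁, ν⟫_ℝ < 0 then g₁ else -g₁⟫_ℝ) ∨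
          ⟪(if ⟪g₁, ν⟫_ℝ < 0 then g₁ else -g₁), ν⟫_ℝ ≤ -t) := by
    intro hlow h; rw [hlow]
    rcases h with h | ⟨-, h⟩
    · exact Or.inl h
    · exact Or.inr (by rw [inner_neg_left]; linarith only [h, dH1])
  have repP : 0 < a + b ∨ (a + b = 0 ∧ g₁ = -A (barlowPos 1 (Real.sqrt (2 / 3)) constHagg 0 1 0)) → (if ⟪g₁, ν⟫_ℝ < 0 then g₁ else -g₁) = A (barlowPos 1 (Real.sqrt (2 / 3)) constHagg 0 1 0) := by
    rintro (hab | ⟨hab, rfl⟩)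
    · have hlt : ⟪A (barlowPos 1 (Real.sqrt (2 / 3)) constHagg 0 1 0), ν⟫_ℝ < 0 := by linarith only [hab, dH1]
      rcases hg₁ with rfl | rfl
      · rw [if_pos hlt]
      · rw [if_neg (by rw [inner_neg_left]; linarith only [hlt]), neg_neg]
    · rw [if_neg (by rw [inner_neg_left]; linarith only [hab, dH1]), neg_neg]
  have repM : a + b < 0 ∨ (a + b = 0 ∧ g₁ = A (barlowPos 1 (Real.sqrt (2 / 3)) constHagg 0 1 0)) → (if ⟪g₁, ν⟫_ℝ < 0 then g₁ else -g₁) = -A (barlowPos 1 (Real.sqrt (2 / 3)) constHagg 0 1 0) := by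
    rintro (hab | ⟨hab, rfl⟩)
    · have hgt : 0 < ⟪A (barlowPos 1 (Real.sqrt (2 / 3)) constHagg 0 1 0), ν⟫_ℝ := by linarith only [hab, dH1]
      rcases hg₁ with rfl | rfl
      · rw [if_neg (not_lt.2 hgt.le)]
      · rw [if_pos (by rw [inner_neg_left]; linarith only [hgt])]
    · rw [if_neg (by linarith only [hab, dH1])]
  -- reading back the `W₃` data
  have hW3read : ((∃ u ∈ K, 1 / 2 < ⟪u, A (barlowPos 1 (Real.sqrt (2 / 3)) constHagg 1 0 (-1))⟫_ℝ) ∨ ⟪A (barlowPos 1 (Real.sqrt (2 / 3)) constHagg 1 0 (-1)), ν⟫_ℝ ≤ -t) → (1 < y₁ - x₁ ∨ 1 < y₂ - x₂ ∨ 1 < y₃ - x₃) := by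
    rintro (h | h)
    · rcases blk _ h with h | h | h
      · exact Or.inl (by linarith only [h, c16])
      · exact Or.inr (Or.inl (by linarith only [h, c26]))
      · exact Or.inr (Or.inr (by linarith only [h, c36]))
    · exfalso; linarith only [h, hraised, ht]
  have hW3feed : (1 < y₁ - x₁ ∨ 1 < y₂ - x₂ ∨ 1 < y₃ - x₃) → ((∃ u ∈ K, 1 / 2 < ⟪u, A (barlowPos 1 (Real.sqrt (2 / 3)) constHagg 1 0 (-1))⟫_ℝ) ∨ ⟪A (barlowPos 1 (Real.sqrt (2 / 3)) constHagg 1 0 (-1)), ν⟫_ℝ ≤ -t) := fun h =>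
    Or.inl (or3' (A (barlowPos 1 (Real.sqrt (2 / 3)) constHagg 1 0 (-1))) (fun (e : 1 < y₁ - x₁) => by linarith only [e, c16]) (fun (e : 1 < y₂ - x₂) => by linarith only [e, c26]) (fun (e : 1 < y₃ - x₃) => by linarith only [e, c36]) h)
  have hDread : ((∃ u ∈ K, 1 / 2 < ⟪u, -A (barlowPos 1 (Real.sqrt (2 / 3)) constHagg 1 0 (-1))⟫_ℝ) ∨ ⟪-A (barlowPos 1 (Real.sqrt (2 / 3)) constHagg 1 0 (-1)), ν⟫_ℝ ≤ -t) → ((1 < x₁ - y₁ ∨ 1 < x₂ - y₂ ∨ 1 < x₃ - y₃) ∨ 2 * t ≤ a - b) := by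
    rintro (h | h)
    · left
      rcases blk _ h with h | h | h
      · rw [inner_neg_right] at h; exact Or.inl (by linarith only [h, c16])
      · rw [inner_neg_right] at h; exact Or.inr (Or.inl (by linarith only [h, c26]))
      · rw [inner_neg_right] at h; exact Or.inr (Or.inr (by linarith only [h, c36]))
    · right; rw [inner_neg_left] at h; linarith only [h, dW3]
  have hL1 : (⟪A (barlowPos 1 (Real.sqrt (2 / 3)) constHagg 0 1 0), ν⟫_ℝ = 0) → a + b = 0 := fun h => by linarith only [h, dH1]
  have hL2 : (⟪A (barlowPos 1 (Real.sqrt (2 / 3)) constHagg 0 0 1), ν⟫_ℝ = 0) → a + c = 0 := fun h => by linarith only [h, dH2]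
  have hL3 : (⟪A (barlowPos 1 (Real.sqrt (2 / 3)) constHagg 0 1 (-1)), ν⟫_ℝ = 0) → c = b := fun h => by linarith only [h, dH3]
  rw [hK]; push_cast
  -- the two landed cap budgets (frame level; the sign conditions from the coordinates)
  have hLand : b < a → 0 < b + c → a < c → (3 : ℝ) ≤ (if ((∃ u ∈ K, 1 / 2 < ⟪u, if ⟪g₁, ν⟫_ℝ < 0 then g₁ else -g₁⟫_ℝ) ∨
          ⟪(if ⟪g₁, ν⟫_ℝ < 0 then g₁ else -g₁), ν⟫_ℝ ≤ -t) then (1 : ℝ) else 0) + 1 / 2 * (if (⟪A (barlowPos 1 (Real.sqrt (2 / 3)) constHagg 0 1 0), ν⟫_ℝ = 0) then (1 : ℝ) else 0) +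
      ((if ((∃ u ∈ K, 1 / 2 < ⟪u, if ⟪g₂, ν⟫_ℝ < 0 then g₂ else -g₂⟫_ℝ) ∨
          ⟪(if ⟪g₂, ν⟫_ℝ < 0 then g₂ else -g₂), ν⟫_ℝ ≤ -t) then (1 : ℝ) else 0) + 1 / 2 * (if (⟪A (barlowPos 1 (Real.sqrt (2 / 3)) constHagg 0 0 1), ν⟫_ℝ = 0) then (1 : ℝ) else 0)) +
      ((if ((∃ u ∈ K, 1 / 2 < ⟪u, if ⟪g₃, ν⟫_ℝ < 0 then g₃ else -g₃⟫_ℝ) ∨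
          ⟪(if ⟪g₃, ν⟫_ℝ < 0 then g₃ else -g₃), ν⟫_ℝ ≤ -t) then (1 : ℝ) else 0) + 1 / 2 * (if (⟪A (barlowPos 1 (Real.sqrt (2 / 3)) constHagg 0 1 (-1)), ν⟫_ℝ = 0) then (1 : ℝ) else 0)) +
      (if ((∃ u ∈ K, 1 / 2 < ⟪u, A (barlowPos 1 (Real.sqrt (2 / 3)) constHagg 1 0 0)⟫_ℝ) ∨ ⟪A (barlowPos 1 (Real.sqrt (2 / 3)) constHagg 1 0 0), ν⟫_ℝ ≤ -t) then (1 : ℝ) else 0) + (if ((∃ u ∈ K, 1 / 2 < ⟪u, A (barlowPos 1 (Real.sqrt (2 / 3)) constHagg 1 (-1) 0)⟫_ℝ) ∨ ⟪A (barlowPos 1 (Real.sqrt (2 / 3)) constHagg 1 (-1) 0), ν⟫_ℝ ≤ -t) then (1 : ℝ) else 0) + (if ((∃ u ∈ K, 1 / 2 < ⟪u, -A (barlowPos 1 (Real.sqrt (2 / 3)) constHagg 1 0 (-1))⟫_ℝ) ∨ ⟪-A (barlowPos 1 (Real.sqrt (2 / 3)) constHagg 1 0 (-1)), ν⟫_ℝ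 ≤ -t) then (1 : ℝ) else 0) := by
    intro hlt hbc hca
    have hw₁ : ⟪A (barlowPos 1 (Real.sqrt (2 / 3)) constHagg 1 0 0), ν⟫_ℝ < 0 := by linarith only [dW1, hbc]
    have hw₂ : ⟪A (barlowPos 1 (Real.sqrt (2 / 3)) constHagg 1 (-1) 0), ν⟫_ℝ < 0 := by linarith only [dW2, hca]
    have hw₃ : 0 < ⟪A (barlowPos 1 (Real.sqrt (2 / 3)) constHagg 1 0 (-1)), ν⟫_ℝ := by linarith only [dW3, hlt]
    have L := predSlotBudget_coreR_landed A ν hν t ht K hK.le hK1 hK2 g₁ g₂ g₃ hg₁ hg₂ hg₃ hw₁ hw₂ hw₃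
    rw [hK] at L; push_cast at L; linarith only [L]
  have hLev : a = b → 0 < b + c → a < c → (3 : ℝ) ≤ (if ((∃ u ∈ K, 1 / 2 < ⟪u, if ⟪g₁, ν⟫_ℝ < 0 then g₁ else -g₁⟫_ℝ) ∨
          ⟪(if ⟪g₁, ν⟫_ℝ < 0 then g₁ else -g₁), ν⟫_ℝ ≤ -t) then (1 : ℝ) else 0) + 1 / 2 * (if (⟪A (barlowPos 1 (Real.sqrt (2 / 3)) constHagg 0 1 0), ν⟫_ℝ = 0) then (1 : ℝ) else 0) +
      ((if ((∃ u ∈ K, 1 / 2 < ⟪u, if ⟪g₂, ν⟫_ℝ < 0 then g₂ else -g₂⟫_ℝ) ∨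
          ⟪(if ⟪g₂, ν⟫_ℝ < 0 then g₂ else -g₂), ν⟫_ℝ ≤ -t) then (1 : ℝ) else 0) + 1 / 2 * (if (⟪A (barlowPos 1 (Real.sqrt (2 / 3)) constHagg 0 0 1), ν⟫_ℝ = 0) then (1 : ℝ) else 0)) +
      ((if ((∃ u ∈ K, 1 / 2 < ⟪u, if ⟪g₃, ν⟫_ℝ < 0 then g₃ else -g₃⟫_ℝ) ∨
          ⟪(if ⟪g₃, ν⟫_ℝ < 0 then g₃ else -g₃), ν⟫_ℝ ≤ -t) then (1 : ℝ) else 0) + 1 / 2 * (if (⟪A (barlowPos 1 (Real.sqrt (2 / 3)) constHagg 0 1 (-1)), ν⟫_ℝ = 0) then (1 : ℝ) else 0)) +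
      (if ((∃ u ∈ K, 1 / 2 < ⟪u, A (barlowPos 1 (Real.sqrt (2 / 3)) constHagg 1 0 0)⟫_ℝ) ∨ ⟪A (barlowPos 1 (Real.sqrt (2 / 3)) constHagg 1 0 0), ν⟫_ℝ ≤ -t) then (1 : ℝ) else 0) + (if ((∃ u ∈ K, 1 / 2 < ⟪u, A (barlowPos 1 (Real.sqrt (2 / 3)) constHagg 1 (-1) 0)⟫_ℝ) ∨ ⟪A (barlowPos 1 (Real.sqrt (2 / 3)) constHagg 1 (-1) 0), ν⟫_ℝ ≤ -t) then (1 : ℝ) else 0) +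
      (1 / 2 * (if (∃ u ∈ K, 1 / 2 < ⟪u, A (barlowPos 1 (Real.sqrt (2 / 3)) constHagg 1 0 (-1))⟫_ℝ) then (1 : ℝ) else 0) + 1 / 2 * (if (∃ u ∈ K, 1 / 2 < ⟪u, -A (barlowPos 1 (Real.sqrt (2 / 3)) constHagg 1 0 (-1))⟫_ℝ) then (1 : ℝ) else 0)) := by
    intro heq hbc hca
    have hw₁ : ⟪A (barlowPos 1 (Real.sqrt (2 / 3)) constHagg 1 0 0), ν⟫_ℝ < 0 := by linarith only [dW1, hbc]
    have hw₂ : ⟪A (barlowPos 1 (Real.sqrt (2 / 3)) constHagg 1 (-1) 0), ν⟫_ℝ < 0 := by linarith only [dW2, hca]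
    have hw₃ : ⟪A (barlowPos 1 (Real.sqrt (2 / 3)) constHagg 1 0 (-1)), ν⟫_ℝ = 0 := by linarith only [dW3, heq]
    have L := predSlotBudget_coreR_landed_level A ν hν t ht K hK.le hK1 hK2 g₁ g₂ g₃ hg₁ hg₂ hg₃ hw₁ hw₂ hw₃
    rw [hK] at L; push_cast at L; linarith only [L]
  have appU : (((1 < x₁ + y₁ ∨ 1 < x₂ + y₂ ∨ 1 < x₃ + y₃) ∨ (0 < a + b ∧ 2 * t ≤ a + b)) → ((∃ u ∈ K, 1 / 2 < ⟪u, if ⟪g₁, ν⟫_ℝ < 0 then g₁ else -g₁⟫_ℝ) ∨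
          ⟪(if ⟪g₁, ν⟫_ℝ < 0 then g₁ else -g₁), ν⟫_ℝ ≤ -t)) →
      0 ≤ a + b → (3 : ℝ) ≤ (if ((∃ u ∈ K, 1 / 2 < ⟪u, if ⟪g₁, ν⟫_ℝ < 0 then g₁ else -g₁⟫_ℝ) ∨
          ⟪(if ⟪g₁, ν⟫_ℝ < 0 then g₁ else -g₁), ν⟫_ℝ ≤ -t) then (1 : ℝ) else 0) +
      (if ((∃ u ∈ K, 1 / 2 < ⟪u, if ⟪g₂, ν⟫_ℝ < 0 then g₂ else -g₂⟫_ℝ) ∨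
          ⟪(if ⟪g₂, ν⟫_ℝ < 0 then g₂ else -g₂), ν⟫_ℝ ≤ -t) then (1 : ℝ) else 0) +
      (if ((∃ u ∈ K, 1 / 2 < ⟪u, if ⟪g₃, ν⟫_ℝ < 0 then g₃ else -g₃⟫_ℝ) ∨
          ⟪(if ⟪g₃, ν⟫_ℝ < 0 then g₃ else -g₃), ν⟫_ℝ ≤ -t) then (1 : ℝ) else 0) +
      (if ((∃ u ∈ K, 1 / 2 < ⟪u, A (barlowPos 1 (Real.sqrt (2 / 3)) constHagg 1 0 0)⟫_ℝ) ∨ ⟪A (barlowPos 1 (Real.sqrt (2 / 3)) constHagg 1 0 0), ν⟫_ℝ ≤ -t) then (1 : ℝ) else 0) +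
      (if ((∃ u ∈ K, 1 / 2 < ⟪u, A (barlowPos 1 (Real.sqrt (2 / 3)) constHagg 1 (-1) 0)⟫_ℝ) ∨ ⟪A (barlowPos 1 (Real.sqrt (2 / 3)) constHagg 1 (-1) 0), ν⟫_ℝ ≤ -t) then (1 : ℝ) else 0) +
      (if ((∃ u ∈ K, 1 / 2 < ⟪u, A (barlowPos 1 (Real.sqrt (2 / 3)) constHagg 1 0 (-1))⟫_ℝ) ∨ ⟪A (barlowPos 1 (Real.sqrt (2 / 3)) constHagg 1 0 (-1)), ν⟫_ℝ ≤ -t) then (1 : ℝ) else 0) := by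
    intro fB1 hab
    obtain ⟨ha, hab', h3a, has, hs0c, hac⟩ := regionR_bounds hn hs hba hab
    have hbc0 : 0 < b + c := by linarith only [hs, ha, hpos]
    refine coreR_three_coords' (T := 2 * t) hn hs hba hab hu₁ hT₁ hu₂ hT₂ hu₃ hT₃ h12 h13 h23
      ((∃ u ∈ K, 1 / 2 < ⟪u, if ⟪g₁, ν⟫_ℝ < 0 then g₁ else -g₁⟫_ℝ) ∨
          ⟪(if ⟪g₁, ν⟫_ℝ < 0 then g₁ else -g₁), ν⟫_ℝ ≤ -t) ((∃ u ∈ K, 1 / 2 < ⟪u, if ⟪g₂, ν⟫_ℝ < 0 then g₂ else -g₂⟫_ℝ) ∨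
          ⟪(if ⟪g₂, ν⟫_ℝ < 0 then g₂ else -g₂), ν⟫_ℝ ≤ -t) ((∃ u ∈ K, 1 / 2 < ⟪u, if ⟪g₃, ν⟫_ℝ < 0 then g₃ else -g₃⟫_ℝ) ∨
          ⟪(if ⟪g₃, ν⟫_ℝ < 0 then g₃ else -g₃), ν⟫_ℝ ≤ -t) ((∃ u ∈ K, 1 / 2 < ⟪u, A (barlowPos 1 (Real.sqrt (2 / 3)) constHagg 1 0 0)⟫_ℝ) ∨ ⟪A (barlowPos 1 (Real.sqrt (2 / 3)) constHagg 1 0 0), ν⟫_ℝ ≤ -t) ((∃ u ∈ K, 1 / 2 < ⟪u, A (barlowPos 1 (Real.sqrt (2 / 3)) constHagg 1 (-1) 0)⟫_ℝ) ∨ ⟪A (barlowPos 1 (Real.sqrt (2 / 3)) constHagg 1 (-1) 0), ν⟫_ℝ ≤ -t) ((∃ u ∈ K, 1 / 2 < ⟪u, A (barlowPos 1 (Real.sqrt (2 / 3)) constHagg 1 0 (-1))⟫_ℝ) ∨ ⟪A (barlowPos 1 (Real.sqrt (2 / 3)) constHagg 1 0 (-1)), ν⟫_ℝ ≤ -t)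 ((∃ u ∈ K, 1 / 2 < ⟪u, -A (barlowPos 1 (Real.sqrt (2 / 3)) constHagg 1 0 (-1))⟫_ℝ) ∨ ⟪-A (barlowPos 1 (Real.sqrt (2 / 3)) constHagg 1 0 (-1)), ν⟫_ℝ ≤ -t) (∃ u ∈ K, 1 / 2 < ⟪u, A (barlowPos 1 (Real.sqrt (2 / 3)) constHagg 1 0 (-1))⟫_ℝ) (∃ u ∈ K, 1 / 2 < ⟪u, -A (barlowPos 1 (Real.sqrt (2 / 3)) constHagg 1 0 (-1))⟫_ℝ) (⟪A (barlowPos 1 (Real.sqrt (2 / 3)) constHagg 0 1 0), ν⟫_ℝ = 0) (⟪A (barlowPos 1 (Real.sqrt (2 / 3)) constHagg 0 0 1), ν⟫_ℝ = 0) (⟪A (barlowPos 1 (Real.sqrt (2 / 3)) constHagg 0 1 (-1)), ν⟫_ℝ = 0)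
      fB1 ?_ ?_ ?_ ?_ ⟨hW3read, hW3feed⟩ hDread (fun h => Or.inl h) hL1 hL2 hL3
      (fun (hlt : b < a) => hLand hlt hbc0 (by linarith only [hs, hlt, has, hpos, hba]))
      (fun (heq : a = b) (hcb : c ≠ b) => hLev heq hbc0 (lt_of_le_of_ne hac (fun h => hcb (by rw [← h, heq]))))
    · intro h0 h; exact feedB2 h0 (or3 (A (barlowPos 1 (Real.sqrt (2 / 3)) constHagg 0 0 1)) (fun (e : 1 < x₁ + z₁) => by linarith only [e, c12]) (fun (e : 1 < x₂ + z₂) => by linarith only [e, c22]) (fun (e : 1 < x₃ + z₃) => by linarith only [e, c32]) h)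
    · intro h0 h; exact feedB3 h0 (or3 (-A (barlowPos 1 (Real.sqrt (2 / 3)) constHagg 0 1 (-1))) (fun (e : 1 < z₁ - y₁) => by rw [inner_neg_right]; linarith only [e, c13]) (fun (e : 1 < z₂ - y₂) => by rw [inner_neg_right]; linarith only [e, c23]) (fun (e : 1 < z₃ - y₃) => by rw [inner_neg_right]; linarith only [e, c33]) h)
    · intro h; exact feedW1 (or3 (A (barlowPos 1 (Real.sqrt (2 / 3)) constHagg 1 0 0)) (fun (e : 1 < y₁ + z₁) => by linarith only [e, c14]) (fun (e : 1 < y₂ + z₂) => by linarith only [e, c24]) (fun (e : 1 < y₃ + z₃) => by linarith only [e, c34]) h)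
    · intro h; exact feedW2 (or3 (A (barlowPos 1 (Real.sqrt (2 / 3)) constHagg 1 (-1) 0)) (fun (e : 1 < z₁ - x₁) => by linarith only [e, c15]) (fun (e : 1 < z₂ - x₂) => by linarith only [e, c25]) (fun (e : 1 < z₃ - x₃) => by linarith only [e, c35]) h)
  have appM : (((1 < -y₁ + -x₁ ∨ 1 < -y₂ + -x₂ ∨ 1 < -y₃ + -x₃) ∨ (0 < -b + -a ∧ 2 * t ≤ -b + -a)) → ((∃ u ∈ K, 1 / 2 < ⟪u, if ⟪g₁, ν⟫_ℝ < 0 then g₁ else -g₁⟫_ℝ) ∨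
          ⟪(if ⟪g₁, ν⟫_ℝ < 0 then g₁ else -g₁), ν⟫_ℝ ≤ -t)) →
      0 ≤ -b + -a → (3 : ℝ) ≤ (if ((∃ u ∈ K, 1 / 2 < ⟪u, if ⟪g₁, ν⟫_ℝ < 0 then g₁ else -g₁⟫_ℝ) ∨
          ⟪(if ⟪g₁, ν⟫_ℝ < 0 then g₁ else -g₁), ν⟫_ℝ ≤ -t) then (1 : ℝ) else 0) +
      (if ((∃ u ∈ K, 1 / 2 < ⟪u, if ⟪g₂, ν⟫_ℝ < 0 then g₂ else -g₂⟫_ℝ) ∨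
          ⟪(if ⟪g₂, ν⟫_ℝ < 0 then g₂ else -g₂), ν⟫_ℝ ≤ -t) then (1 : ℝ) else 0) +
      (if ((∃ u ∈ K, 1 / 2 < ⟪u, if ⟪g₃, ν⟫_ℝ < 0 then g₃ else -g₃⟫_ℝ) ∨
          ⟪(if ⟪g₃, ν⟫_ℝ < 0 then g₃ else -g₃), ν⟫_ℝ ≤ -t) then (1 : ℝ) else 0) +
      (if ((∃ u ∈ K, 1 / 2 < ⟪u, A (barlowPos 1 (Real.sqrt (2 / 3)) constHagg 1 0 0)⟫_ℝ) ∨ ⟪A (barlowPos 1 (Real.sqrt (2 / 3)) constHagg 1 0 0), ν⟫_ℝ ≤ -t) then (1 : ℝ) else 0) +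
      (if ((∃ u ∈ K, 1 / 2 < ⟪u, A (barlowPos 1 (Real.sqrt (2 / 3)) constHagg 1 (-1) 0)⟫_ℝ) ∨ ⟪A (barlowPos 1 (Real.sqrt (2 / 3)) constHagg 1 (-1) 0), ν⟫_ℝ ≤ -t) then (1 : ℝ) else 0) +
      (if ((∃ u ∈ K, 1 / 2 < ⟪u, A (barlowPos 1 (Real.sqrt (2 / 3)) constHagg 1 0 (-1))⟫_ℝ) ∨ ⟪A (barlowPos 1 (Real.sqrt (2 / 3)) constHagg 1 0 (-1)), ν⟫_ℝ ≤ -t) then (1 : ℝ) else 0) := by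
    intro fB1 hab
    have hn' : (-b) ^ 2 + (-a) ^ 2 + c ^ 2 = 2 := by linarith only [hn]
    have hs' : Real.sqrt (2 / 3) ≤ -(-b) + (-a) + c := by linarith only [hs]
    have hba' : -a ≤ -b := by linarith only [hba]
    obtain ⟨ha, hab', h3a, has, hs0c, hac⟩ := regionR_bounds hn' hs' hba' hab
    have := coreR_three_coords' (T := 2 * t) (a := -b) (b := -a) (c := c)
      (x₁ := -y₁) (y₁ := -x₁) (z₁ := z₁) (x₂ := -y₂) (y₂ := -x₂) (z₂ := z₂) (x₃ := -y₃) (y₃ := -x₃) (z₃ := z₃)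
      hn' hs' hba' hab (by linarith only [hu₁]) (by linarith only [hT₁]) (by linarith only [hu₂]) (by linarith only [hT₂])
      (by linarith only [hu₃]) (by linarith only [hT₃]) (by linarith only [h12]) (by linarith only [h13]) (by linarith only [h23])
      ((∃ u ∈ K, 1 / 2 < ⟪u, if ⟪g₁, ν⟫_ℝ < 0 then g₁ else -g₁⟫_ℝ) ∨
          ⟪(if ⟪g₁, ν⟫_ℝ < 0 then g₁ else -g₁), ν⟫_ℝ ≤ -t) ((∃ u ∈ K, 1 / 2 < ⟪u, if ⟪g₃, ν⟫_ℝ < 0 then g₃ else -g₃⟫_ℝ) ∨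
          ⟪(if ⟪g₃, ν⟫_ℝ < 0 then g₃ else -g₃), ν⟫_ℝ ≤ -t) ((∃ u ∈ K, 1 / 2 < ⟪u, if ⟪g₂, ν⟫_ℝ < 0 then g₂ else -g₂⟫_ℝ) ∨
          ⟪(if ⟪g₂, ν⟫_ℝ < 0 then g₂ else -g₂), ν⟫_ℝ ≤ -t) ((∃ u ∈ K, 1 / 2 < ⟪u, A (barlowPos 1 (Real.sqrt (2 / 3)) constHagg 1 (-1) 0)⟫_ℝ) ∨ ⟪A (barlowPos 1 (Real.sqrt (2 / 3)) constHagg 1 (-1) 0), ν⟫_ℝ ≤ -t) ((∃ u ∈ K, 1 / 2 < ⟪u, A (barlowPos 1 (Real.sqrt (2 / 3)) constHagg 1 0 0)⟫_ℝ) ∨ ⟪A (barlowPos 1 (Real.sqrt (2 / 3)) constHagg 1 0 0), ν⟫_ℝ ≤ -t) ((∃ u ∈ K, 1 / 2 < ⟪u, A (barlowPos 1 (Real.sqrt (2 / 3)) constHagg 1 0 (-1))⟫_ℝ) ∨ ⟪A (barlowPos 1 (Real.sqrt (2 / 3)) constHagg 1 0 (-1)), ν⟫_ℝ ≤ -t)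 ((∃ u ∈ K, 1 / 2 < ⟪u, -A (barlowPos 1 (Real.sqrt (2 / 3)) constHagg 1 0 (-1))⟫_ℝ) ∨ ⟪-A (barlowPos 1 (Real.sqrt (2 / 3)) constHagg 1 0 (-1)), ν⟫_ℝ ≤ -t) (∃ u ∈ K, 1 / 2 < ⟪u, A (barlowPos 1 (Real.sqrt (2 / 3)) constHagg 1 0 (-1))⟫_ℝ) (∃ u ∈ K, 1 / 2 < ⟪u, -A (barlowPos 1 (Real.sqrt (2 / 3)) constHagg 1 0 (-1))⟫_ℝ) (⟪A (barlowPos 1 (Real.sqrt (2 / 3)) constHagg 0 1 0), ν⟫_ℝ = 0) (⟪A (barlowPos 1 (Real.sqrt (2 / 3)) constHagg 0 1 (-1)), ν⟫_ℝ = 0) (⟪A (barlowPos 1 (Real.sqrt (2 / 3)) constHagg 0 0 1), ν⟫_ℝ = 0)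
      fB1 ?_ ?_ ?_ ?_ ?_ ?_ (fun h => Or.inl h) (fun h => by linarith only [hL1 h]) (fun h => by linarith only [hL3 h]) (fun h => by linarith only [hL2 h])
      (fun (hlt : -a < -b) => by
        have hbc0 : 0 < b + c := by linarith only [hs, has, hlt, hpos]
        have h := hLand (by linarith only [hlt]) hbc0 (by linarith only [hs, hab, has, hpos, hlt])
        linarith only [h])
      (fun (heq : -b = -a) (hcb : c ≠ -a) => by
        have hbc0 : 0 < b + c := by
          rcases lt_or_eq_of_le (show 0 ≤ b + c by linarith only [hs, has, heq, hpos]) with h | h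
          · exact h
          · exfalso; apply hcb; nlinarith only [h, heq, hn, hs0c, hpos]
        have h := hLev (by linarith only [heq]) hbc0 (by linarith only [hs0c, hpos, hab, heq])
        linarith only [h])
    · linarith only [this]
    · intro h0 h; exact feedB3 (by linarith only [h0]) ((or3 (-A (barlowPos 1 (Real.sqrt (2 / 3)) constHagg 0 1 (-1))) (fun (e : 1 < -y₁ + z₁) => by rw [inner_neg_right]; linarith only [e, c13]) (fun (e : 1 < -y₂ + z₂) => by rw [inner_neg_right]; linarith only [e, c23]) (fun (e : 1 < -y₃ + z₃) => by rw [inner_neg_right]; linarith only [e, c33]) h).imp id (fun (e : 2 * t ≤ -b + c) => by linarith only [e]))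
    · intro h0 h; exact feedB2 (by linarith only [hs, hpos, ha, hac, h0, has]) ((or3 (A (barlowPos 1 (Real.sqrt (2 / 3)) constHagg 0 0 1)) (fun (e : 1 < z₁ - -x₁) => by linarith only [e, c12]) (fun (e : 1 < z₂ - -x₂) => by linarith only [e, c22]) (fun (e : 1 < z₃ - -x₃) => by linarith only [e, c32]) h).imp id (fun (e : 2 * t ≤ c - -a) => by linarith only [e]))
    · intro h; exact feedW2 ((or3 (A (barlowPos 1 (Real.sqrt (2 / 3)) constHagg 1 (-1) 0)) (fun (e : 1 < -x₁ + z₁) => by linarith only [e, c15]) (fun (e : 1 < -x₂ + z₂) => by linarith only [e, c25]) (fun (e : 1 < -x₃ + z₃) => by linarith only [e, c35]) h).imp id (fun (e : 2 * t ≤ -a + c) => by linarith only [e]))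
    · intro h; exact feedW1 ((or3 (A (barlowPos 1 (Real.sqrt (2 / 3)) constHagg 1 0 0)) (fun (e : 1 < z₁ - -y₁) => by linarith only [e, c14]) (fun (e : 1 < z₂ - -y₂) => by linarith only [e, c24]) (fun (e : 1 < z₃ - -y₃) => by linarith only [e, c34]) h).imp id (fun (e : 2 * t ≤ c - -b) => by linarith only [e]))
    · constructor
      · intro h; rcases hW3read h with e | e | e
        · exact Or.inl (by linarith only [e])
        · exact Or.inr (Or.inl (by linarith only [e]))
        · exact Or.inr (Or.inr (by linarith only [e]))
      · intro h; apply hW3feed; rcases h with e | e | e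
        · exact Or.inl (by linarith only [e])
        · exact Or.inr (Or.inl (by linarith only [e]))
        · exact Or.inr (Or.inr (by linarith only [e]))
    · intro h; rcases hDread h with (e | e | e) | e
      · exact Or.inl (Or.inl (by linarith only [e]))
      · exact Or.inl (Or.inr (Or.inl (by linarith only [e])))
      · exact Or.inl (Or.inr (Or.inr (by linarith only [e])))
      · exact Or.inr (by linarith only [e])
  -- choice of the orientation
  rcases lt_trichotomy 0 (a + b) with hab | hab | hab
  · exact appU (fun h => feedB1P (repP (Or.inl hab)) ((h.imp (or3' (A (barlowPos 1 (Real.sqrt (2 / 3)) constHagg 0 1 0)) (fun (e : 1 < x₁ + y₁) => by linarith only [e, c11]) (fun (e : 1 < x₂ + y₂) => by linarith only [e, c21]) (fun (e : 1 < x₃ + y₃) => by linarith only [e, c31])) id))) hab.le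
  · rcases hg₁ with hg | hg
    · -- level hex pair, `g₁ = A h₁`: the representative is `−A h₁`; mirrored orientation
      exact appM (fun h => feedB1M (repM (Or.inr ⟨hab.symm, hg⟩)) (h.imp (or3' (-A (barlowPos 1 (Real.sqrt (2 / 3)) constHagg 0 1 0)) (fun (e : 1 < -y₁ + -x₁) => by rw [inner_neg_right]; linarith only [e, c11]) (fun (e : 1 < -y₂ + -x₂) => by rw [inner_neg_right]; linarith only [e, c21]) (fun (e : 1 < -y₃ + -x₃) => by rw [inner_neg_right]; linarith only [e, c31])) id)) (by linarith only [hab])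
    · exact appU (fun h => feedB1P (repP (Or.inr ⟨hab.symm, hg⟩)) (h.imp (or3' (A (barlowPos 1 (Real.sqrt (2 / 3)) constHagg 0 1 0)) (fun (e : 1 < x₁ + y₁) => by linarith only [e, c11]) (fun (e : 1 < x₂ + y₂) => by linarith only [e, c21]) (fun (e : 1 < x₃ + y₃) => by linarith only [e, c31])) id)) hab.le
  · exact appM (fun h => feedB1M (repM (Or.inl hab)) (h.imp (or3' (-A (barlowPos 1 (Real.sqrt (2 / 3)) constHagg 0 1 0)) (fun (e : 1 < -y₁ + -x₁) => by rw [inner_neg_right]; linarith only [e, c11]) (fun (e : 1 < -y₂ + -x₂) => by rw [inner_neg_right]; linarith only [e, c21]) (fun (e : 1 < -y₃ + -x₃) => by rw [inner_neg_right]; linarith only [e, c31])) id)) (by linarith only [hab])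

end Summit.Ventures.Crystal3D.Theorems

end
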